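import Mathlib
import HarnessLib
import Summits.ResolutionOfSingularities.ResolutionOfSingularities.Theorems.WildQuotientsWildQuotientResolutionKSBlowupLocalChart

/-!
# Kollár–Szabó going down, (K2-centres), scheme side: local charts of the blow-up along an ARBITRARY stable centre
# and their fixed closed points (crux `WildQuotients.WildQuotientResolution`, stub `stub_phaseZeroHighDim`)

Crux stmt-ResolutionOfSingularities-15640 (`WildQuotientResolution`), registered stub `stub_phaseZeroHighDim`;
programme PHASE0-KS-EIGENLINE, item (K2-centres) of the remaining-lemma list (memo MEMO-KS-WILD-EXTENSION-DESIGN.md):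
fixed points of the lifted action on blow-ups along `G`-stable REGULAR CENTRES `Z ∋ x` (the moves of the Phase-0
game), not only along points. ✓`KSBlowupLocalChart` (p828603) did the scheme side for the centre `{x}`; the only
point-specific input there was `(𝓘_{x})_x = 𝔪_x`. This file states the same mechanism for an arbitrary centre ideal
sheaf `I` with `σ_g⁻¹ I = I`:

* `isEffectiveCartier_comap_specMap_fromSpecStalk_of_stalkIdeal` — `Spec R → Spec 𝒪_{X,x} → X` pulls `I` back to an
  effective Cartier divisor as soon as `I_x · R = (t)`, `t` a non-zero-divisor;
* `exists_localChart_of_stalkIdeal` — the local chart `φ : Spec R → X'` of the blow-up along `I`;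
* `exists_fixedPoint_of_localChart_of_stalkIdeal`, `exists_fixedPoint_liftAction_of_localChart_of_stalkIdeal` — the
  fixed closed point WITH INERTIA of the (lifted) action, from a residue-trivial equivariant local ring `R` over
  `𝒪_{X,x}` with `I_x R = (t)` — so the only remaining input for (K2-centres) is algebraic: the `σ`-stable local
  blow-up ring `S[I_x/t]_𝔫` at an eigenline of `I_x/𝔪 I_x` (generalising ✓`EigenlineChart`, hand 8-g1).

[OURS · crux stmt-ResolutionOfSingularities-15640 · helper toward `stub_phaseZeroHighDim` (scheme side of (K2-centres);
NOT a proof of the stub); folklore (Stacks 0804), counted 0; AI-level work, weaker than expert review.] [folklore]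
-/

-- single-problem summit: the doubled namespace component `ResolutionOfSingularities` is forced
set_option linter.dupNamespace false

noncomputable section

open CategoryTheory CategoryTheory.Limits AlgebraicGeometry TopologicalSpace IsLocalRing
open Literature.AlgebraicGeometry.Ramification Literature.AlgebraicGeometry.Resolution
open Scheme.IdealSheafData

namespace Summit.ResolutionOfSingularities.ResolutionOfSingularities.Theorems.WildQuotientResolution.KSGoingDown

universe u

variable {X' X : Scheme.{u}} {π : X' ⟶ X} {x : X} {I : X.IdealSheafData}

/-- **`Spec R → Spec 𝒪_{X,x} → X` pulls the centre `I` back to an effective Cartier divisor** as soon as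
`I_x · R = (t)` with `t` a non-zero-divisor of `R`. [cite: StacksProject, Tag 0804] -/
theorem isEffectiveCartier_comap_specMap_fromSpecStalk_of_stalkIdeal
    {R : Type u} [CommRing R] (ι : X.presheaf.stalk x →+* R) {t : R} (ht : t ∈ nonZeroDivisors R)
    (hmap : (stalkIdeal I x).map ι = Ideal.span {t}) :
    IsEffectiveCartier (I.comap (Spec.map (CommRingCat.ofHom ι) ≫ X.fromSpecStalk x)) := by
  rw [Scheme.IdealSheafData.comap_comp, comap_fromSpecStalk_eq_affineBlowupIdealSheaf,
    comap_idealSheaf_specMap, hmap]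
  exact affineBlowup.isEffectiveCartier_idealSheaf_span_singleton ht

/-- **The local chart of the blow-up along `I`**: `φ : Spec R → X'` over `Spec R → Spec 𝒪_{X,x} → X`.
[cite: StacksProject, Tag 0804] -/
theorem exists_localChart_of_stalkIdeal (hπ : IsBlowup π I)
    {R : Type u} [CommRing R] (ι : X.presheaf.stalk x →+* R) {t : R} (ht : t ∈ nonZeroDivisors R)
    (hmap : (stalkIdeal I x).map ι = Ideal.span {t}) :
    ∃ φ : Spec (.of R) ⟶ X', φ ≫ π = Spec.map (CommRingCat.ofHom ι) ≫ X.fromSpecStalk x :=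
  ⟨hπ.lift _ (isEffectiveCartier_comap_specMap_fromSpecStalk_of_stalkIdeal ι ht hmap), hπ.lift_comp _ _⟩

/-- **The fixed point with inertia from an equivariant local chart, arbitrary stable centre.** Let `π : X' → X`
be a blowing up along an ideal sheaf `I` stable under an action `σ` (`σ_g⁻¹ I = I`), `σ'` an action on `X'` over
`σ`, `a_g` a stalk action at `x` over `σ`, `ι : 𝒪_{X,x} → R` a LOCAL map to a local ring with `I_x R = (t)`
(`t` a non-zero-divisor) carrying residue-trivial ring endomorphisms `α_g` extending the `a_g`. Then the closed point
of `Spec R` maps under the local chart to a point `x'` over `x` at which every `g` lies in the inertia group of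
`σ'`. [folklore] -/
theorem exists_fixedPoint_of_localChart_of_stalkIdeal (hπ : IsBlowup π I)
    {G : Type u} [Group G] (σ : G →* Aut X) (hI : ∀ g, I.comap (σ g).hom = I)
    (σ' : G →* Aut X') (hσ' : ∀ g, (σ' g).hom ≫ π = π ≫ (σ g).hom)
    (a : G → (X.presheaf.stalk x ⟶ X.presheaf.stalk x))
    (hkey : ∀ g, Spec.map (a g) ≫ X.fromSpecStalk x = X.fromSpecStalk x ≫ (σ g).hom)
    {R : Type u} [CommRing R] [IsLocalRing R] (ι : X.presheaf.stalk x →+* R) [IsLocalHom ι]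
    {t : R} (ht : t ∈ nonZeroDivisors R) (hmap : (stalkIdeal I x).map ι = Ideal.span {t})
    (α : G → (R →+* R)) (hα : ∀ g, (α g).comp ι = ι.comp (a g).hom)
    (hres : ∀ (g : G) (r : R), α g r - r ∈ maximalIdeal R) :
    ∃ (φ : Spec (.of R) ⟶ X') (x' : X'),
      φ ≫ π = Spec.map (CommRingCat.ofHom ι) ≫ X.fromSpecStalk x ∧ φ (closedPoint R) = x' ∧
      π x' = x ∧ ∀ g, g ∈ inertiaSubgroup σ' x' := by
  obtain ⟨φ, hφ⟩ := exists_localChart_of_stalkIdeal hπ ι ht hmap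
  have hEC : IsEffectiveCartier (I.comap (φ ≫ π)) := by
    rw [hφ]
    exact isEffectiveCartier_comap_specMap_fromSpecStalk_of_stalkIdeal ι ht hmap
  have ha : ∀ g, Spec.map (CommRingCat.ofHom (α g)) ≫ φ ≫ π = φ ≫ π ≫ (σ g).hom := by
    intro g
    rw [hφ, ← Category.assoc φ π, hφ]
    exact specMap_comp_fromSpecStalk_equivariant (fun g => (σ g).hom) a hkey ι α hα g
  let p : Spec (.of (ResidueField R)) ⟶ Spec (.of R) := Spec.map (CommRingCat.ofHom (residue R))
  have hp : ∀ g, p ≫ Spec.map (CommRingCat.ofHom (α g)) = p := fun g =>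
    specMap_residue_comp_eq_of_sub_mem (α g) (hres g)
  have hinert : ∀ g, g ∈ inertiaSubgroup σ' ((p ≫ φ) (closedPoint (ResidueField R))) := fun g =>
    mem_inertiaSubgroup_of_isBlowup_of_fixed_fieldPoint hπ σ σ' hσ' hI hEC ha p hp g
  have hpc : p (closedPoint (ResidueField R)) = closedPoint R := by
    haveI : IsLocalHom (CommRingCat.ofHom (residue R)).hom := inferInstanceAs (IsLocalHom (residue R))
    exact Spec_closedPoint
  have hx' : (p ≫ φ) (closedPoint (ResidueField R)) = φ (closedPoint R) := by
    rw [Scheme.Hom.comp_apply, hpc]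
  refine ⟨φ, φ (closedPoint R), hφ, rfl, ?_, fun g => hx' ▸ hinert g⟩
  rw [← Scheme.Hom.comp_apply, hφ]
  exact specMap_comp_fromSpecStalk_closedPoint ι

/-- The same for the LIFTED action ✓`IsBlowup.liftAction` on the blow-up along the stable centre `I`. [folklore] -/
theorem exists_fixedPoint_liftAction_of_localChart_of_stalkIdeal (hπ : IsBlowup π I)
    {G : Type u} [Group G] (σ : G →* Aut X) (hI : ∀ g, I.comap (σ g).hom = I)
    (a : G → (X.presheaf.stalk x ⟶ X.presheaf.stalk x))
    (hkey : ∀ g, Spec.map (a g) ≫ X.fromSpecStalk x = X.fromSpecStalk x ≫ (σ g).hom)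
    {R : Type u} [CommRing R] [IsLocalRing R] (ι : X.presheaf.stalk x →+* R) [IsLocalHom ι]
    {t : R} (ht : t ∈ nonZeroDivisors R) (hmap : (stalkIdeal I x).map ι = Ideal.span {t})
    (α : G → (R →+* R)) (hα : ∀ g, (α g).comp ι = ι.comp (a g).hom)
    (hres : ∀ (g : G) (r : R), α g r - r ∈ maximalIdeal R) :
    ∃ (φ : Spec (.of R) ⟶ X') (x' : X'),
      φ ≫ π = Spec.map (CommRingCat.ofHom ι) ≫ X.fromSpecStalk x ∧ φ (closedPoint R) = x' ∧
      π x' = x ∧ ∀ g, g ∈ inertiaSubgroup (hπ.liftAction σ hI) x' :=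
  exists_fixedPoint_of_localChart_of_stalkIdeal hπ σ hI _ (hπ.liftAction_hom_comp σ hI) a hkey ι ht hmap α hα
    hres

/-- For a `G`-stable CLOSED SUBSET `Z` (e.g. a regular stable centre) the stability hypothesis of the blow-up along
its reduced ideal sheaf is ✓`vanishingIdeal_comap_eq_of_action`; packaged form of the previous theorem. [folklore] -/
theorem exists_fixedPoint_liftAction_of_localChart_vanishingIdeal {Z : Closeds X}
    (hπ : IsBlowup π (vanishingIdeal Z)) {G : Type u} [Group G] (σ : G →* Aut X)
    (hZ : ∀ g, (σ g).hom.base ⁻¹' (Z : Set X) = Z)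
    (a : G → (X.presheaf.stalk x ⟶ X.presheaf.stalk x))
    (hkey : ∀ g, Spec.map (a g) ≫ X.fromSpecStalk x = X.fromSpecStalk x ≫ (σ g).hom)
    {R : Type u} [CommRing R] [IsLocalRing R] (ι : X.presheaf.stalk x →+* R) [IsLocalHom ι]
    {t : R} (ht : t ∈ nonZeroDivisors R) (hmap : (stalkIdeal (vanishingIdeal Z) x).map ι = Ideal.span {t})
    (α : G → (R →+* R)) (hα : ∀ g, (α g).comp ι = ι.comp (a g).hom)
    (hres : ∀ (g : G) (r : R), α g r - r ∈ maximalIdeal R) :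
    ∃ (φ : Spec (.of R) ⟶ X') (x' : X'),
      φ ≫ π = Spec.map (CommRingCat.ofHom ι) ≫ X.fromSpecStalk x ∧ φ (closedPoint R) = x' ∧
      π x' = x ∧ ∀ g, g ∈ inertiaSubgroup (hπ.liftAction σ (vanishingIdeal_comap_eq_of_action σ Z hZ)) x' :=
  exists_fixedPoint_liftAction_of_localChart_of_stalkIdeal hπ σ _ a hkey ι ht hmap α hα hres

end Summit.ResolutionOfSingularities.ResolutionOfSingularities.Theorems.WildQuotientResolution.KSGoingDown

end
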